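import Mathlib

/-!
# Lead a1 on "line" `rungs-r2-ideator5` (crux stmt-Parity-0870 `PolyMobiusTail`): the two rung candidates are ONE rung

Companion to `line-rungs-r2-ideator5.dead.md`.  The seated "skeleton" `RungsIdeator5R2.lean` (crux dir, sha256
42390773…, byte-identical to the evidence file `rungs-r2-ideator5.lean`) types three statements about `λ(n²+1)` and,
by its own header, is NOT a line on the crux (no `stub_*`, no `PolyMobiusTail_of`; `lean check` audit `closes = []`).

This file records, kernel-checked, the one mathematical remark the lead adds for the ladder planner: the two rung
candidates `BiasBoundXSqAddOne` (R1) and `SignDensityXSqAddOne` (R1') are EQUIVALENT (elementary counting: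
`λ(n²+1) ∈ {±1}`, so `Σ_{n≤x} λ(n²+1) = P(x) - M(x)` with `P(x) + M(x) = x`), and both follow from the atom
`ChowlaXSqAddOne`.  So the ladder carries one rung here, not two.  Nothing in this file bears on the crux.

Definitions `ChowlaXSqAddOne`, `BiasBoundXSqAddOne`, `SignDensityXSqAddOne` are copied VERBATIM from
`Cruxes/PolyMobiusTail/RungsIdeator5R2.lean` (namespace changed to avoid a clash; that file is not a built module).
-/

open Filter Finset Asymptotics

namespace Summit.Parity.BatemanHorn.Cruxes.PolyMobiusTail.LeadA1

/-- The parity atom of the crux at `X² + 1`, Liouville form (verbatim from `RungsIdeator5R2.lean`). -/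
def ChowlaXSqAddOne : Prop :=
  (fun x : ℕ => ∑ n ∈ Icc 1 x, (ArithmeticFunction.liouville (n ^ 2 + 1) : ℝ)) =o[atTop]
    fun x : ℕ => (x : ℝ)

/-- Rung candidate R1 (verbatim from `RungsIdeator5R2.lean`). -/
def BiasBoundXSqAddOne : Prop :=
  ∃ δ : ℝ, 0 < δ ∧ ∀ᶠ x : ℕ in atTop,
    |∑ n ∈ Icc 1 x, (ArithmeticFunction.liouville (n ^ 2 + 1) : ℝ)| ≤ (1 - δ) * x

/-- Rung candidate R1' (verbatim from `RungsIdeator5R2.lean`). -/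
def SignDensityXSqAddOne : Prop :=
  ∀ v : ℤ, v = 1 ∨ v = -1 → ∃ δ : ℝ, 0 < δ ∧ ∀ᶠ x : ℕ in atTop,
    δ * (x : ℝ) ≤ #((Icc 1 x).filter fun n : ℕ => ArithmeticFunction.liouville (n ^ 2 + 1) = v)

/-- `λ(n² + 1) ∈ {1, -1}`. -/
theorem liouville_sq_add_one_eq_or (n : ℕ) :
    ArithmeticFunction.liouville (n ^ 2 + 1) = 1 ∨ ArithmeticFunction.liouville (n ^ 2 + 1) = -1 := by
  rw [ArithmeticFunction.liouville_apply (Nat.succ_ne_zero _)]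
  exact neg_one_pow_eq_or ℤ _

/-- The count of `n ∈ [1, x]` with `λ(n²+1) = 1`. -/
noncomputable def posCount (x : ℕ) : ℕ :=
  #((Icc 1 x).filter fun n : ℕ => ArithmeticFunction.liouville (n ^ 2 + 1) = 1)

/-- The count of `n ∈ [1, x]` with `λ(n²+1) = -1`. -/
noncomputable def negCount (x : ℕ) : ℕ :=
  #((Icc 1 x).filter fun n : ℕ => ArithmeticFunction.liouville (n ^ 2 + 1) = -1)

/-- The complement of `{λ = 1}` inside `[1, x]` is `{λ = -1}`. -/
theorem filter_not_pos_eq_neg (x : ℕ) :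
    ((Icc 1 x).filter fun n : ℕ => ¬ ArithmeticFunction.liouville (n ^ 2 + 1) = 1) =
      (Icc 1 x).filter fun n : ℕ => ArithmeticFunction.liouville (n ^ 2 + 1) = -1 := by
  refine Finset.filter_congr fun n _ => ?_
  rcases liouville_sq_add_one_eq_or n with h | h
  · simp [h]
  · simp [h]

/-- `P(x) + M(x) = x`. -/
theorem posCount_add_negCount (x : ℕ) : posCount x + negCount x = x := by
  have h := Finset.card_filter_add_card_filter_not
    (s := Icc 1 x) (p := fun n : ℕ => ArithmeticFunction.liouville (n ^ 2 + 1) = 1)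
  rw [filter_not_pos_eq_neg] at h
  simpa [posCount, negCount] using h

/-- `Σ_{n ≤ x} λ(n²+1) = P(x) - M(x)`. -/
theorem sum_liouville_eq_posCount_sub_negCount (x : ℕ) :
    ∑ n ∈ Icc 1 x, (ArithmeticFunction.liouville (n ^ 2 + 1) : ℝ) =
      (posCount x : ℝ) - (negCount x : ℝ) := by
  rw [← Finset.sum_filter_add_sum_filter_not (Icc 1 x)
    (fun n : ℕ => ArithmeticFunction.liouville (n ^ 2 + 1) = 1), filter_not_pos_eq_neg]
  have hP : ∑ n ∈ (Icc 1 x).filter (fun n : ℕ => ArithmeticFunction.liouville (n ^ 2 + 1) = 1),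
      (ArithmeticFunction.liouville (n ^ 2 + 1) : ℝ) = (posCount x : ℝ) := by
    rw [posCount, Finset.card_eq_sum_ones, Nat.cast_sum]
    refine Finset.sum_congr rfl fun n hn => ?_
    rw [(Finset.mem_filter.mp hn).2]; simp
  have hM : ∑ n ∈ (Icc 1 x).filter (fun n : ℕ => ArithmeticFunction.liouville (n ^ 2 + 1) = -1),
      (ArithmeticFunction.liouville (n ^ 2 + 1) : ℝ) = -(negCount x : ℝ) := by
    rw [negCount, Finset.card_eq_sum_ones, Nat.cast_sum, ← Finset.sum_neg_distrib]
    refine Finset.sum_congr rfl fun n hn => ?_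
    rw [(Finset.mem_filter.mp hn).2]; simp
  rw [hP, hM]; ring

/-- R1 ⇒ R1': a bias bound `|P - M| ≤ (1-δ)x` with `P + M = x` forces `P, M ≥ (δ/2)·x`. -/
theorem signDensity_of_biasBound (h : BiasBoundXSqAddOne) : SignDensityXSqAddOne := by
  obtain ⟨δ, hδ, hev⟩ := h
  intro v hv
  refine ⟨δ / 2, by positivity, ?_⟩
  filter_upwards [hev] with x hx
  rw [sum_liouville_eq_posCount_sub_negCount] at hx
  have hsum : (posCount x : ℝ) + (negCount x : ℝ) = x := by exact_mod_cast posCount_add_negCount x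
  have habs := abs_le.mp hx
  rcases hv with rfl | rfl
  · show δ / 2 * (x : ℝ) ≤ (posCount x : ℝ)
    linarith [habs.1, habs.2]
  · show δ / 2 * (x : ℝ) ≤ (negCount x : ℝ)
    linarith [habs.1, habs.2]

/-- R1' ⇒ R1: lower densities `δ₊, δ₋` of the two signs give the bias bound with `δ = 2·min(δ₊, δ₋)`. -/
theorem biasBound_of_signDensity (h : SignDensityXSqAddOne) : BiasBoundXSqAddOne := by
  obtain ⟨δ₁, hδ₁, h₁⟩ := h 1 (Or.inl rfl)
  obtain ⟨δ₂, hδ₂, h₂⟩ := h (-1) (Or.inr rfl)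
  refine ⟨2 * min δ₁ δ₂, by positivity, ?_⟩
  filter_upwards [h₁, h₂] with x hx₁ hx₂
  change δ₁ * (x : ℝ) ≤ (posCount x : ℝ) at hx₁
  change δ₂ * (x : ℝ) ≤ (negCount x : ℝ) at hx₂
  rw [sum_liouville_eq_posCount_sub_negCount]
  have hsum : (posCount x : ℝ) + (negCount x : ℝ) = x := by exact_mod_cast posCount_add_negCount x
  have hmin₁ : min δ₁ δ₂ ≤ δ₁ := min_le_left _ _
  have hmin₂ : min δ₁ δ₂ ≤ δ₂ := min_le_right _ _
  have hx0 : (0 : ℝ) ≤ x := Nat.cast_nonneg x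
  have hm₁ : min δ₁ δ₂ * (x : ℝ) ≤ (posCount x : ℝ) :=
    (mul_le_mul_of_nonneg_right hmin₁ hx0).trans hx₁
  have hm₂ : min δ₁ δ₂ * (x : ℝ) ≤ (negCount x : ℝ) :=
    (mul_le_mul_of_nonneg_right hmin₂ hx0).trans hx₂
  rw [abs_le]
  constructor <;> nlinarith

/-- The two rung candidates of `RungsIdeator5R2.lean` are one rung. -/
theorem biasBound_iff_signDensity : BiasBoundXSqAddOne ↔ SignDensityXSqAddOne :=
  ⟨signDensity_of_biasBound, biasBound_of_signDensity⟩

/-- The atom implies the bias bound (with `δ = 1/2`; proof verbatim from `RungsIdeator5R2.lean`). -/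
theorem biasBound_of_chowla (h : ChowlaXSqAddOne) : BiasBoundXSqAddOne := by
  refine ⟨1 / 2, by norm_num, ?_⟩
  have := h.def (c := 1 / 2) (by norm_num)
  filter_upwards [this] with x hx
  rw [Real.norm_eq_abs, Real.norm_eq_abs, Nat.abs_cast] at hx
  linarith

/-- The atom implies that each sign of `λ(n²+1)` has lower density `≥ 1/4` (in fact `1/2 - ε`). -/
theorem signDensity_of_chowla (h : ChowlaXSqAddOne) : SignDensityXSqAddOne :=
  signDensity_of_biasBound (biasBound_of_chowla h)

end Summit.Parity.BatemanHorn.Cruxes.PolyMobiusTail.LeadA1
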